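import Literature.Geometry.Riemannian.BoundaryNormalCoordinates
import Literature.Geometry.Riemannian.CylinderMetricExtension
import Literature.Geometry.Lorentzian.LocalIsometryScalarCurvature
import Literature.Geometry.Manifold.BilinSectionTransport
import HarnessLib

/-!
# The metric of a piece near its boundary as a generalized cylinder (Bär–Hanke 2023, §3, (7)–(9))

Topic `Literature/Geometry/Riemannian`. Assembly of layer L1 with the cylinder calculus of the
proof programme of `Literature.Geometry.Riemannian.BaerHankePscGluing`. Bär–Hanke, §3: near the
boundary every metric is `dt² + g_t` ((7), (8)) and its scalar curvature is given by the
generalized-cylinder formula (9). In the tree: from the boundary normal coordinates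
`E : ∂M × (-ε, ε) → P` of the piece `(M, g_M)` inside the boundaryless `P`
(`exists_boundaryNormalCoordinates`: `E^*ĝ` is semigeodesic on the tube, `ĝ` an extension of
`g_M`), the field `E^*ĝ` is extended (`exists_cylinderMetric_extension`) to a Riemannian metric
`G` on the WHOLE cylinder `∂M × ℝ` with the cylinder property, equal to `E^*ĝ` on
`∂M × (-ε', ε')`; by naturality (`scalarCurvature_eq_of_val_eq_pullbackBilin`)
`scal_G(z, t) = scal_ĝ(E(z, t))` there, and `scal_ĝ(jM a) = scal_{g_M}(a)` at interior points.
Hence every statement of the generalized-cylinder files (`ġ_t = 2K_t`, Riccati, (9), the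
`C`-normal boundary formula) applies to `(M, g_M)` near `∂M`.

* `exists_boundaryCylinderMetric` — the package: `ĝ`, `ε' > 0`, the normal geodesics, the two
  sides of the tube, smoothness and immersivity of `E` on the tube, the cylinder metric `G` with
  `G = E^*ĝ` and `scal_G = scal_ĝ ∘ E` on `∂M × (-ε', ε')`, and `scal_ĝ ∘ jM = scal_{g_M}` on
  `Int M`.

No definitions, no named facts (D-0026).

## References

* C. Bär, B. Hanke, *Boundary conditions for scalar curvature*, arXiv:2012.09127, §3, (7)–(9).
  [BarHanke2023]
* J. M. Lee, *Introduction to Riemannian Manifolds*, 2nd ed. (2018), Example 6.44.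
  [LeeRiemannianManifolds2018]
-/

noncomputable section

open Bundle Set Function Filter Metric
open scoped Manifold ContDiff Topology

attribute [-instance] SimplexCategory.instFintypeToTypeOrderHomFinHAddNatLenOfNat

namespace Literature.Geometry.Riemannian

open Literature.Geometry.Lorentzian Literature.Geometry.Lorentzian.PseudoRiemannianMetric
  Literature.Geometry.Manifold Literature.Topology.FourManifolds

universe u

variable {n : ℕ} {M : Type u} [TopologicalSpace M] [ChartedSpace (EuclideanHalfSpace (n + 2)) M]
  [IsManifold (𝓡∂ (n + 2)) ∞ M] [CompactSpace M]
  {P : Type u} [TopologicalSpace P] [ChartedSpace (EuclideanSpace ℝ (Fin (n + 2))) P]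
  [IsManifold (𝓡 (n + 2)) ∞ P] [T2Space P] [CompactSpace P]
  (bM : BoundaryData (𝓡∂ (n + 2)) M (𝓡 (n + 1)))

set_option synthInstance.maxHeartbeats 400000 in
set_option maxHeartbeats 1600000 in
/-- **The piece near its boundary is a generalized cylinder** (Bär–Hanke 2023, §3, (7)–(9)).
With the hypotheses of `exists_boundaryNormalCoordinates` (`jM : M ↪ P` equidimensional `C^∞`
embedding of the compact piece into a compact boundaryless `P`, `g_M` Riemannian with
Levi-Civita connection, `ν_M` a `C^∞` outward unit normal along `∂M`, `∂M ≠ ∅`): there are an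
extension `ĝ` of `g_M` to `P`, `ε > 0` with the normal geodesics `E(z, t) = exp_{jM(incl z)}(t ν)`,
`ν = d(jM)(-ν_M)`, defined for `|t| < ε` (with the Fermi chart `ψ` inverting them, `C^∞` both
ways), lying in `jM(Int M)` for `t > 0` and outside `jM(M)`
for `t < 0`, and a Riemannian `C^∞` metric `G` on `∂M × ℝ` with the cylinder property such that
on `∂M × (-ε, ε)`: `G = E^*ĝ` and `scal_G(z,t) = scal_ĝ(E(z,t))`; moreover
`scal_ĝ(jM a) = scal_{g_M}(a)` for `a ∈ Int M`. [cite: BarHanke2023, §3, (7)–(9)] -/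
theorem exists_boundaryCylinderMetric [Nonempty bM.carrier] {jM : M → P}
    (hjM : Manifold.IsSmoothEmbedding (𝓡∂ (n + 2)) (𝓡 (n + 2)) ∞ jM)
    (gM : PseudoRiemannianMetric (𝓡∂ (n + 2)) ∞ (EuclideanSpace ℝ (Fin (n + 2)))
      (TangentSpace (𝓡∂ (n + 2)) : M → Type _)) [gM.HasLeviCivita] (hgM : gM.IsRiemannian)
    (νM : NormalField (𝓡∂ (n + 2)) bM.incl) (hunit : gM.IsUnitNormal (𝓡 (n + 1)) bM.incl νM 1)
    (hνs : ContMDiff (𝓡 (n + 1)) (𝓡∂ (n + 2)).tangent ∞ (fun z ↦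
      (TotalSpace.mk' (EuclideanSpace ℝ (Fin (n + 2))) (bM.incl z) (νM z) :
        TangentBundle (𝓡∂ (n + 2)) M)))
    (hout : ∀ z, (show EuclideanSpace ℝ (Fin (n + 2)) from νM z) 0 < 0) :
    ∃ g : PseudoRiemannianMetric (𝓡 (n + 2)) ∞ (EuclideanSpace ℝ (Fin (n + 2)))
        (TangentSpace (𝓡 (n + 2)) : P → Type _), ∃ _ : g.HasLeviCivita,
      g.IsRiemannian ∧
      (∀ (a : M) (v w : TangentSpace (𝓡∂ (n + 2)) a),
        g.val (jM a) (mfderiv (𝓡∂ (n + 2)) (𝓡 (n + 2)) jM a v)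
          (mfderiv (𝓡∂ (n + 2)) (𝓡 (n + 2)) jM a w) = gM.val a v w) ∧
      (∀ a : M, (𝓡∂ (n + 2)).IsInteriorPoint a → g.scalarCurvature (jM a) = gM.scalarCurvature a) ∧
      ∃ ε : ℝ, 0 < ε ∧
        (∀ (z : bM.carrier), ∀ t ∈ Ioo (-ε) ε,
          t ∈ maximalGeodesicDomain g.leviCivita (jM (bM.incl z))
            (mfderiv (𝓡∂ (n + 2)) (𝓡 (n + 2)) jM (bM.incl z) (-νM z))) ∧
        (∀ (z : bM.carrier), ∀ t ∈ Ioo 0 ε,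
          expMap g.leviCivita (jM (bM.incl z))
              (t • mfderiv (𝓡∂ (n + 2)) (𝓡 (n + 2)) jM (bM.incl z) (-νM z)) ∈
            jM '' (𝓡∂ (n + 2)).interior M) ∧
        (∀ (z : bM.carrier), ∀ t ∈ Ioo (-ε) 0,
          expMap g.leviCivita (jM (bM.incl z))
              (t • mfderiv (𝓡∂ (n + 2)) (𝓡 (n + 2)) jM (bM.incl z) (-νM z)) ∉ range jM) ∧
        (∀ q : bM.carrier × ℝ, q.2 ∈ Ioo (-ε) ε →
          ContMDiffAt ((𝓡 (n + 1)).prod 𝓘(ℝ, ℝ)) (𝓡 (n + 2)) ∞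
            (fun q : bM.carrier × ℝ ↦ expMap g.leviCivita (jM (bM.incl q.1))
              (q.2 • mfderiv (𝓡∂ (n + 2)) (𝓡 (n + 2)) jM (bM.incl q.1) (-νM q.1))) q ∧
          Injective (mfderiv ((𝓡 (n + 1)).prod 𝓘(ℝ, ℝ)) (𝓡 (n + 2))
            (fun q : bM.carrier × ℝ ↦ expMap g.leviCivita (jM (bM.incl q.1))
              (q.2 • mfderiv (𝓡∂ (n + 2)) (𝓡 (n + 2)) jM (bM.incl q.1) (-νM q.1))) q)) ∧
        (∃ ψ : OpenPartialHomeomorph P (bM.carrier × ℝ),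
          ψ.source = (fun q : bM.carrier × ℝ ↦ expMap g.leviCivita (jM (bM.incl q.1))
              (q.2 • mfderiv (𝓡∂ (n + 2)) (𝓡 (n + 2)) jM (bM.incl q.1) (-νM q.1))) ''
              ((univ : Set bM.carrier) ×ˢ Ioo (-ε) ε) ∧
          ψ.target = (univ : Set bM.carrier) ×ˢ Ioo (-ε) ε ∧
          (∀ q, ψ.symm q = expMap g.leviCivita (jM (bM.incl q.1))
              (q.2 • mfderiv (𝓡∂ (n + 2)) (𝓡 (n + 2)) jM (bM.incl q.1) (-νM q.1))) ∧
          (∀ q ∈ (univ : Set bM.carrier) ×ˢ Ioo (-ε) ε, ψ (expMap g.leviCivita (jM (bM.incl q.1))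
              (q.2 • mfderiv (𝓡∂ (n + 2)) (𝓡 (n + 2)) jM (bM.incl q.1) (-νM q.1))) = q) ∧
          ContMDiffOn (𝓡 (n + 2)) ((𝓡 (n + 1)).prod 𝓘(ℝ, ℝ)) ∞ ψ ψ.source ∧
          ContMDiffOn ((𝓡 (n + 1)).prod 𝓘(ℝ, ℝ)) (𝓡 (n + 2)) ∞ ψ.symm ψ.target ∧
          (∀ z : bM.carrier, jM (bM.incl z) ∈ ψ.source)) ∧
        ∃ G : PseudoRiemannianMetric ((𝓡 (n + 1)).prod 𝓘(ℝ, ℝ)) ∞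
            (EuclideanSpace ℝ (Fin (n + 1)) × ℝ)
            (TangentSpace ((𝓡 (n + 1)).prod 𝓘(ℝ, ℝ)) : bM.carrier × ℝ → Type _),
          ∃ _ : G.HasLeviCivita,
          G.IsRiemannian ∧
          (∀ (p : bM.carrier × ℝ) (v w : TangentSpace ((𝓡 (n + 1)).prod 𝓘(ℝ, ℝ)) p),
            G.val p v w = G.val p ((v.1, 0) : TangentSpace ((𝓡 (n + 1)).prod 𝓘(ℝ, ℝ)) p)
              ((w.1, 0) : TangentSpace ((𝓡 (n + 1)).prod 𝓘(ℝ, ℝ)) p) + v.2 * w.2) ∧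
          (∀ (z : bM.carrier), ∀ t ∈ Ioo (-ε) ε,
            G.val (z, t) = pullbackBilin (I := 𝓡 (n + 2)) (I' := (𝓡 (n + 1)).prod 𝓘(ℝ, ℝ))
              (fun q : bM.carrier × ℝ ↦ expMap g.leviCivita (jM (bM.incl q.1))
                (q.2 • mfderiv (𝓡∂ (n + 2)) (𝓡 (n + 2)) jM (bM.incl q.1) (-νM q.1)))
              g.val (z, t)) ∧
          (∀ (z : bM.carrier), ∀ t ∈ Ioo (-ε) ε,
            G.scalarCurvature (z, t) = g.scalarCurvature (expMap g.leviCivita (jM (bM.incl z))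
              (t • mfderiv (𝓡∂ (n + 2)) (𝓡 (n + 2)) jM (bM.incl z) (-νM z)))) := by
  haveI : Fact (1 ≤ (∞ : ℕ∞ω)) := ⟨by exact_mod_cast le_top⟩
  obtain ⟨g, hLC, hgR, hpull, ε, hε, hdom, ⟨ψ, hsrc, htgt, hsymm, hleft, hψ, hψs, hSeam⟩, hblock,
    hplus, hminus⟩ := exists_boundaryNormalCoordinates bM hjM gM hgM νM hunit hνs hout
  haveI := hLC
  set I2 := (𝓡 (n + 1)).prod 𝓘(ℝ, ℝ) with hI2
  set T : bM.carrier × ℝ → P := fun q ↦ expMap g.leviCivita (jM (bM.incl q.1))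
    (q.2 • mfderiv (𝓡∂ (n + 2)) (𝓡 (n + 2)) jM (bM.incl q.1) (-νM q.1)) with hT
  -- `T` is `C^∞` with injective differential on the tube
  have hTeq : ∀ q, ψ.symm q = T q := hsymm
  have hTs : ∀ q : bM.carrier × ℝ, q.2 ∈ Ioo (-ε) ε → ContMDiffAt I2 (𝓡 (n + 2)) ∞ T q := by
    intro q hq
    have hqt : q ∈ ψ.target := by rw [htgt]; exact ⟨mem_univ _, hq⟩
    have h := (hψs q hqt).contMDiffAt (ψ.open_target.mem_nhds hqt)
    exact h.congr_of_eventuallyEq (Eventually.of_forall fun q' ↦ (hTeq q').symm)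
  have hTinj : ∀ q : bM.carrier × ℝ, q.2 ∈ Ioo (-ε) ε →
      Injective (mfderiv I2 (𝓡 (n + 2)) T q) := by
    intro q hq
    have hqt : q ∈ ψ.target := by rw [htgt]; exact ⟨mem_univ _, hq⟩
    have hTq : T q ∈ ψ.source := by rw [← hTeq]; exact ψ.map_target hqt
    have hψd : MDifferentiableAt (𝓡 (n + 2)) I2 ψ (T q) :=
      ((hψ _ hTq).contMDiffAt (ψ.open_source.mem_nhds hTq)).mdifferentiableAt (by simp)
    have hTd : MDifferentiableAt I2 (𝓡 (n + 2)) T q := (hTs q hq).mdifferentiableAt (by simp)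
    -- `ψ ∘ T = id` near `q`
    have hid : ∀ᶠ q' in 𝓝 q, (ψ ∘ T) q' = id q' := by
      have hopen : IsOpen ((univ : Set bM.carrier) ×ˢ Ioo (-ε) ε) := isOpen_univ.prod isOpen_Ioo
      filter_upwards [hopen.mem_nhds (show q ∈ (univ : Set bM.carrier) ×ˢ Ioo (-ε) ε from
        ⟨mem_univ _, hq⟩)] with q' hq'
      exact hleft q' hq'
    have hcomp : mfderiv I2 I2 (ψ ∘ T) q = (mfderiv (𝓡 (n + 2)) I2 ψ (T q)).comp
        (mfderiv I2 (𝓡 (n + 2)) T q) := mfderiv_comp q hψd hTd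
    have hid' : mfderiv I2 I2 (ψ ∘ T) q = ContinuousLinearMap.id ℝ _ := by
      rw [Filter.EventuallyEq.mfderiv_eq hid, mfderiv_id]
    intro v w hvw
    have h := congrArg (mfderiv (𝓡 (n + 2)) I2 ψ (T q)) hvw
    rw [← ContinuousLinearMap.comp_apply, ← ContinuousLinearMap.comp_apply, ← hcomp, hid'] at h
    exact h
  -- the pulled-back field `s = T^* ĝ` on `∂M × ℝ`
  set s : Π p : bM.carrier × ℝ, TangentSpace I2 p →L[ℝ] TangentSpace I2 p →L[ℝ] ℝ :=
    pullbackBilin (I := 𝓡 (n + 2)) (I' := I2) T g.val with hs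
  have hs_apply : ∀ (p : bM.carrier × ℝ) (v w : TangentSpace I2 p),
      s p v w = g.val (T p) (mfderiv I2 (𝓡 (n + 2)) T p v) (mfderiv I2 (𝓡 (n + 2)) T p w) :=
    fun p v w ↦ rfl
  have hs_smooth : ∀ p : bM.carrier × ℝ, p.2 ∈ ball (0 : ℝ) ε → ContMDiffAt I2
      (I2.prod 𝓘(ℝ, (EuclideanSpace ℝ (Fin (n + 1)) × ℝ) →L[ℝ]
        (EuclideanSpace ℝ (Fin (n + 1)) × ℝ) →L[ℝ] ℝ)) ∞
      (fun q : bM.carrier × ℝ ↦ TotalSpace.mk' ((EuclideanSpace ℝ (Fin (n + 1)) × ℝ) →L[ℝ]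
        (EuclideanSpace ℝ (Fin (n + 1)) × ℝ) →L[ℝ] ℝ)
        (E := fun q : bM.carrier × ℝ ↦ TangentSpace I2 q →L[ℝ] TangentSpace I2 q →L[ℝ] ℝ)
        q (s q)) p := by
    intro p hp
    have hp' : p.2 ∈ Ioo (-ε) ε := by
      rw [mem_ball, Real.dist_eq, sub_zero] at hp
      exact ⟨by linarith [(abs_lt.1 hp).1], (abs_lt.1 hp).2⟩
    exact contMDiffAt_pullbackBilin_of_contMDiffAt (hTs p hp') (g.contMDiff (T p))
  have hs_symm : ∀ p : bM.carrier × ℝ, p.2 ∈ ball (0 : ℝ) ε → ∀ v w, s p v w = s p w v :=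
    fun p _ v w ↦ by rw [hs_apply, hs_apply, g.symm]
  have hIoo_of_ball : ∀ t : ℝ, t ∈ ball (0 : ℝ) ε → t ∈ Ioo (-ε) ε := fun t ht ↦ by
    rw [mem_ball, Real.dist_eq, sub_zero] at ht
    exact ⟨by linarith [(abs_lt.1 ht).1], (abs_lt.1 ht).2⟩
  have hs_pos : ∀ p : bM.carrier × ℝ, p.2 ∈ ball (0 : ℝ) ε → ∀ v, v ≠ 0 → 0 < s p v v := by
    intro p hp v hv
    rw [hs_apply]
    refine hgR (T p) _ fun h0 ↦ hv (hTinj p (hIoo_of_ball p.2 hp) ?_)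
    rw [h0, map_zero]
  have hs_cyl : ∀ p : bM.carrier × ℝ, p.2 ∈ ball (0 : ℝ) ε → ∀ v w : TangentSpace I2 p,
      s p v w = s p ((v.1, 0) : TangentSpace I2 p) ((w.1, 0) : TangentSpace I2 p) + v.2 * w.2 := by
    rintro ⟨z, t⟩ hp v w
    obtain ⟨w₁, a⟩ := v
    obtain ⟨w₁', a'⟩ := w
    rw [hs_apply, hs_apply]
    have h := hblock z t (hIoo_of_ball t hp) w₁ w₁' a a'
    rw [h]
    ring
  -- a Riemannian metric on `∂M`: the induced one
  have hincl : ContMDiff (𝓡 (n + 1)) (𝓡∂ (n + 2)) ∞ bM.incl := bM.isSmoothEmbedding.contMDiff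
  have hfi : gM.IsSpacelikeImmersion (𝓡 (n + 1)) bM.incl := by
    refine ⟨hincl, fun z v hv ↦ ?_⟩
    rw [inducedBilin_apply]
    refine hgM (bM.incl z) _ fun h0 ↦ hv ?_
    exact injective_mfderiv_of_isImmersionAt'
      (bM.isSmoothEmbedding.isImmersion.isImmersionAt z) (by rw [h0, map_zero])
  set gS := gM.inducedMetric bM.incl (contMDiff_pullbackBilin_holds (I := 𝓡∂ (n + 2)) (M := M)
    (I' := 𝓡 (n + 1)) (N := bM.carrier)) hfi with hgS
  have hgSR : gS.IsRiemannian := isRiemannian_inducedMetric (g := gM) (f := bM.incl) _ hfi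
  -- the global cylinder metric
  have hε2 : (0 : ℝ) < ε / 2 := by linarith
  obtain ⟨G, hGR, hGcyl, hGs⟩ := exists_cylinderMetric_extension gS hgSR s hε2
    (by linarith : ε / 2 < ε) hs_smooth hs_symm hs_pos hs_cyl
  haveI hGLC : G.HasLeviCivita := G.hasLeviCivita
  -- `G = T^* ĝ` on the half-width slab
  have hGval : ∀ (z : bM.carrier), ∀ t ∈ Ioo (-(ε / 2)) (ε / 2), G.val (z, t) = s (z, t) := by
    intro z t ht
    refine hGs (z, t) ?_
    rw [mem_closedBall, Real.dist_eq, sub_zero]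
    exact abs_le.2 ⟨by linarith [ht.1], by linarith [ht.2]⟩
  -- naturality of the scalar curvature on the slab
  have hdim : Module.finrank ℝ (EuclideanSpace ℝ (Fin (n + 1)) × ℝ) =
      Module.finrank ℝ (EuclideanSpace ℝ (Fin (n + 2))) := by
    rw [Module.finrank_prod, Module.finrank_self, finrank_euclideanSpace_fin,
      finrank_euclideanSpace_fin]
  have hUopen : IsOpen ((univ : Set bM.carrier) ×ˢ Ioo (-(ε / 2)) (ε / 2)) :=
    isOpen_univ.prod isOpen_Ioo
  have hsub : ∀ q : bM.carrier × ℝ, q ∈ (univ : Set bM.carrier) ×ˢ Ioo (-(ε / 2)) (ε / 2) →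
      q.2 ∈ Ioo (-ε) ε := fun q hq ↦ ⟨by linarith [hq.2.1], by linarith [hq.2.2]⟩
  have hscalG : ∀ (z : bM.carrier), ∀ t ∈ Ioo (-(ε / 2)) (ε / 2),
      G.scalarCurvature (z, t) = g.scalarCurvature (T (z, t)) := by
    intro z t ht
    exact scalarCurvature_eq_of_val_eq_pullbackBilin g G hUopen
      (fun q hq ↦ hTs q (hsub q hq)) (fun q hq ↦ hTinj q (hsub q hq)) hdim
      (fun q hq ↦ hGval q.1 q.2 hq.2) (q := (z, t)) ⟨mem_univ _, ht⟩
  -- naturality along the embedding `jM` at interior points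
  have hscalM : ∀ a : M, (𝓡∂ (n + 2)).IsInteriorPoint a →
      g.scalarCurvature (jM a) = gM.scalarCurvature a := by
    intro a ha
    have hopen : IsOpen ((𝓡∂ (n + 2)).interior M) :=
      ModelWithCorners.isOpen_interior (I := 𝓡∂ (n + 2)) (M := M) (n := ∞) (by simp)
    have hval : ∀ q ∈ (𝓡∂ (n + 2)).interior M, gM.val q =
        pullbackBilin (I := 𝓡 (n + 2)) (I' := 𝓡∂ (n + 2)) jM g.val q := by
      intro q _
      refine ContinuousLinearMap.ext fun v ↦ ContinuousLinearMap.ext fun w ↦ ?_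
      rw [pullbackBilin_apply, hpull]
    have h := scalarCurvature_eq_of_val_eq_pullbackBilin g gM hopen
      (fun q _ ↦ hjM.contMDiff q)
      (fun q _ ↦ injective_mfderiv_of_isImmersionAt' (hjM.isImmersion.isImmersionAt q)) rfl
      hval (q := a) ha
    exact h.symm
  -- the Fermi chart restricted to the half-width slab: `ψ' = (ψ.symm.restrOpen S).symm`
  have hSsub : (univ : Set bM.carrier) ×ˢ Ioo (-(ε / 2)) (ε / 2) ⊆ ψ.target := by
    rw [htgt]
    rintro ⟨z, t⟩ ⟨-, ht⟩
    exact ⟨mem_univ _, by linarith [ht.1], by linarith [ht.2]⟩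
  haveI h1cov : CovariantDerivative.ContMDiffCovariantDerivative g.leviCivita 1 :=
    contMDiffCovariantDerivative_leviCivita_of_two_le g (WithTop.coe_le_coe.2 le_top)
  have hT0 : ∀ z : bM.carrier, T (z, 0) = jM (bM.incl z) := fun z ↦ by
    show expMap g.leviCivita (jM (bM.incl z))
      ((0 : ℝ) • mfderiv (𝓡∂ (n + 2)) (𝓡 (n + 2)) jM (bM.incl z) (-νM z)) = _
    rw [zero_smul]
    exact expMap_zero (cov := g.leviCivita) _
  have hψ'symm : ∀ q, (ψ.symm.restrOpen _ hUopen).symm.symm q = T q := fun q ↦ by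
    rw [OpenPartialHomeomorph.symm_symm, OpenPartialHomeomorph.coe_restrOpen]
    exact hTeq q
  have hψ'tgt : (ψ.symm.restrOpen _ hUopen).symm.target =
      (univ : Set bM.carrier) ×ˢ Ioo (-(ε / 2)) (ε / 2) := by
    show ψ.symm.source ∩ (univ : Set bM.carrier) ×ˢ Ioo (-(ε / 2)) (ε / 2) = _
    rw [OpenPartialHomeomorph.symm_source]
    exact inter_eq_right.2 hSsub
  have hψ'src : (ψ.symm.restrOpen _ hUopen).symm.source =
      T '' ((univ : Set bM.carrier) ×ˢ Ioo (-(ε / 2)) (ε / 2)) := by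
    show ψ.symm.target ∩ ψ.symm.symm ⁻¹' ((univ : Set bM.carrier) ×ˢ Ioo (-(ε / 2)) (ε / 2)) = _
    rw [OpenPartialHomeomorph.symm_target, OpenPartialHomeomorph.symm_symm]
    ext p
    constructor
    · rintro ⟨hp, hpS⟩
      refine ⟨ψ p, hpS, ?_⟩
      rw [← hTeq]
      exact ψ.left_inv hp
    · rintro ⟨q, hq, rfl⟩
      refine ⟨?_, ?_⟩
      · rw [← hTeq]
        exact ψ.map_target (hSsub hq)
      · show ψ (T q) ∈ (univ : Set bM.carrier) ×ˢ Ioo (-(ε / 2)) (ε / 2)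
        rw [hleft q ⟨mem_univ _, hsub q hq⟩]
        exact hq
  have hψ'left : ∀ q ∈ (univ : Set bM.carrier) ×ˢ Ioo (-(ε / 2)) (ε / 2),
      (ψ.symm.restrOpen _ hUopen).symm (T q) = q := fun q hq ↦ by
    rw [OpenPartialHomeomorph.coe_restrOpen_symm, OpenPartialHomeomorph.symm_symm]
    exact hleft q ⟨mem_univ _, hsub q hq⟩
  have hψ's : ContMDiffOn (𝓡 (n + 2)) I2 ∞ (ψ.symm.restrOpen _ hUopen).symm
      (ψ.symm.restrOpen _ hUopen).symm.source := by
    rw [hψ'src, OpenPartialHomeomorph.coe_restrOpen_symm, OpenPartialHomeomorph.symm_symm]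
    refine hψ.mono ?_
    rintro _ ⟨q, hq, rfl⟩
    rw [← hTeq]
    exact ψ.map_target (hSsub hq)
  have hψ'ss : ContMDiffOn I2 (𝓡 (n + 2)) ∞ (ψ.symm.restrOpen _ hUopen).symm.symm
      (ψ.symm.restrOpen _ hUopen).symm.target := by
    rw [hψ'tgt, OpenPartialHomeomorph.symm_symm, OpenPartialHomeomorph.coe_restrOpen]
    exact hψs.mono hSsub
  have hψ'seam : ∀ z : bM.carrier, jM (bM.incl z) ∈ (ψ.symm.restrOpen _ hUopen).symm.source :=
    fun z ↦ by
    rw [hψ'src, ← hT0 z]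
    exact mem_image_of_mem T ⟨mem_univ _, by linarith, by linarith⟩
  refine ⟨g, hLC, hgR, hpull, hscalM, ε / 2, hε2, ?_, ?_, ?_, ?_,
    ⟨(ψ.symm.restrOpen _ hUopen).symm, hψ'src, hψ'tgt, hψ'symm, hψ'left, hψ's, hψ'ss, hψ'seam⟩,
    G, hGLC, hGR, hGcyl, ?_, ?_⟩
  · exact fun z t ht ↦ hdom z t ⟨by linarith [ht.1], by linarith [ht.2]⟩
  · exact fun z t ht ↦ hplus z t ⟨ht.1, by linarith [ht.2]⟩
  · exact fun z t ht ↦ hminus z t ⟨by linarith [ht.1], ht.2⟩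
  · exact fun q hq ↦ ⟨hTs q ⟨by linarith [hq.1], by linarith [hq.2]⟩,
      hTinj q ⟨by linarith [hq.1], by linarith [hq.2]⟩⟩
  · exact hGval
  · exact hscalG

end Literature.Geometry.Riemannian
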